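import Summits.ResolutionOfSingularities.ResolutionOfSingularities.Theorems.FrobeniusLadderFInjectiveMacaulayficationLocalFullificationDimFourFibre
import HarnessLib

/-!
# (LF) `LocalFullificationFibreGe4` — the d-UNIFORM fibre-supported local FULL-ification statement at points of local dimension `d ≥ 4`
# (crux `FInjectiveMacaulayfication` stmt-ResolutionOfSingularities-15315, chain w45a; res-L1-w45a-plan-1 RULING R17.4 «LD = the d-uniform LOCAL
# DOOR», object (E3); seat res-L1-w45a-stub-2 g6)

[OURS · L1 W4.5a] STATEMENT file (`--supports stmt-ResolutionOfSingularities-15315 --as helper`); ONE `Prop`-valued CANDIDATE statement of OURS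
(`@[conjecture] def`, consumed only as a hypothesis; no instance, no notation, no named fact) and its comparison with (L4♭); replaces the role of NO
printed item; NOT a statement of the manuscript; AI-written (AI review is weaker than expert review).

WHAT. (LF) = `∀ d : ℕ, 4 ≤ d →` the body of (L4♭) `LocalFullificationDimFourFibre.LocalFullificationDimFourFibre` (p586372) with the SINGLE substitution
`ringKrullDim (X.presheaf.stalk x) = 4` ↦ `ringKrullDim (X.presheaf.stalk x) = d` — nothing else touched. In words: for `X/k` an integral variety
(`char k = p`), a point `x` of local dimension `d ≥ 4`, and a blowing up `g : S′ → Spec 𝒪_{X,x}` along `I ≠ ⊥` that is REGULAR off its closed fibre,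
there is a centre `𝓚 ≠ ⊥` on `S′` supported in the closed fibre all of whose blowings up are FULL (domain ∧ CM-clause ∧ F-clause) at every point.
* `localFullificationDimFourFibre_of_ge4 : LocalFullificationFibreGe4 → LocalFullificationDimFourFibre` — the slice `d = 4` (trivial).

WHY (plan-1 R17.4). THEOREM A's Noetherian induction (Temkin 2008 Prop. 2.3.4; tree `DesingularizationOffClosedPoints`, generalised by
res-L1-w45a-stub-3's (E1) `DesingularizationOffClosedPointsGen` to every dimension) leaves, on a `d`-fold, a blow-up model regular off FINITELY MANY
CLOSED points `b` (of local dimension `d`); the F-Temkin stage at those points (this seat's p586439, to be generalised in (E5) `FTemkinClosedPointsGen`)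
consumes exactly (LF) at `d := dim X`. Together with (LR) `LocalResolutionNonClosedGe4` (local RESOLUTION of blow-ups of `Spec 𝒪_{X,x}` at NON-closed
`x` of local dimension `≥ 4`; stub-3's (E2)) the whole crux factors through two LOCAL statements, both ≤ S_loc: door v36 «LocalDoor». The F-ladder
saves work only at the closed points of the top dimension; below, genuine resolution keeps «regular off the fibre» (KILL 1, p579933: FULL-off-fibre
inputs do not suffice).
JUNK CHECKS: as for (L4♭) — `I ≠ ⊥` excludes `S′ = ∅`; `S′` regular ⇒ `𝓚 := ⊤`; NON-closed `x` of local dimension `d` (ambient dimension `> d`) is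
covered verbatim and harmless (the door uses (LF) only at closed points). ≤ S_loc(d): a resolution of `S′` by a `Sing S′`-supported blowing up is
fibre-supported (Sing S′ ⊆ fibre) and regular ⇒ FULL.
[candidate statement, OURS; cite: Temkin2008, Prop. 2.3.4 and Lemma 2.1.1 (shape)]
-/

-- single-problem summit: the doubled namespace component is forced
set_option linter.dupNamespace false

noncomputable section

open AlgebraicGeometry CategoryTheory Literature.AlgebraicGeometry.Resolution TopologicalSpace IsLocalRing

namespace Summit.ResolutionOfSingularities.ResolutionOfSingularities.Theorems.FInjectiveMacaulayfication.LocalFullificationFibreGe4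

open Summit.ResolutionOfSingularities.ResolutionOfSingularities.Theorems.FInjectiveMacaulayfication

/-- [OURS · CANDIDATE statement, not a fact] **(LF) LOCAL FULL-IFICATION AT LOCAL DIMENSION `d ≥ 4`, FIBRE-SUPPORTED CENTRE.** For every `d ≥ 4`:
for a prime `p`, a field `k` of characteristic `p`, an integral separated `k`-scheme `X` of finite type, a point `x ∈ X` with `dim 𝒪_{X,x} = d`, and a
blowing up `g : S′ → Spec 𝒪_{X,x}` along an ideal sheaf `I ≠ ⊥` such that `S′` is REGULAR at every point off the closed fibre `g⁻¹(x)`: there is an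
ideal sheaf `𝓚 ≠ ⊥` on `S′`, supported in the closed fibre, such that EVERY blowing up `S″ → S′` along `𝓚` is FULL at EVERY point
(`SliceableCentre.FullCl`). The slice `d = 4` is (L4♭) `LocalFullificationDimFourFibre`. [candidate statement, OURS; open for every `d ≥ 4`] -/
@[conjecture] def LocalFullificationFibreGe4 : Prop :=
  ∀ d : ℕ, 4 ≤ d →
  ∀ (p : ℕ), p.Prime → ∀ (k : Type) [Field k] [CharP k p]
    (X : Scheme.{0}) (f : X ⟶ Spec (.of k)),
      IsSeparated f → LocallyOfFiniteType f → QuasiCompact f → IsIntegral X →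
      ∀ x : X, ringKrullDim (X.presheaf.stalk x) = d →
      ∀ (S' : Scheme.{0}) (g : S' ⟶ Spec (X.presheaf.stalk x)) (I : (Spec (X.presheaf.stalk x)).IdealSheafData),
        I ≠ ⊥ → IsBlowup g I →
        (∀ s : S', g.base s ≠ closedPoint (X.presheaf.stalk x) → s ∈ Scheme.regularLocus S') →
        ∃ 𝓚 : S'.IdealSheafData, 𝓚 ≠ ⊥ ∧ (∀ s ∈ (𝓚.support : Set S'), g.base s = closedPoint (X.presheaf.stalk x)) ∧
          ∀ (S'' : Scheme.{0}) (π : S'' ⟶ S'), IsBlowup π 𝓚 →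
            ∀ s : S'', SliceableCentre.FullCl p (S''.presheaf.stalk s)

/-- **(LF) ⇒ (L4♭)**: the slice `d = 4`. [folklore] -/
theorem localFullificationDimFourFibre_of_ge4 (h : LocalFullificationFibreGe4) :
    LocalFullificationDimFourFibre.LocalFullificationDimFourFibre :=
  fun p hp k _ _ X f hsep hft hqc hint x hx => h 4 le_rfl p hp k X f hsep hft hqc hint x (by exact_mod_cast hx)

end Summit.ResolutionOfSingularities.ResolutionOfSingularities.Theorems.FInjectiveMacaulayfication.LocalFullificationFibreGe4

end
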